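import Literature.AlgebraicGeometry.Resolution.ArithmeticalThreefoldsHeadReduction
import Literature.AlgebraicGeometry.Resolution.LocalUniformization3RankOne
import HarnessLib

/-!
# Cossart–Piltant 2019, Prop. 4.8: the geometric head of the descent at RANK ONE suffices

Topic: `Literature/AlgebraicGeometry/Resolution` (proofs only; no new notions, no new named
facts). `ArithmeticalThreefoldsHeadReduction.lean` reduces the descent leaf
`CossartPiltant2019LU3OfComplete` (journal Prop. 4.8 = arXiv v1 Prop. 4.6 of Cossart–Piltant,
*Resolution of singularities of arithmetical threefolds*, J. Algebra 529 (2019) = arXiv:1412.0868)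
to the GEOMETRIC HEAD of the printed proof (`CossartPiltant2019LU3OfComplete.of_head`; named
`CossartPiltant2019_descentHead` in `ArithmeticalThreefoldsDescentHead.lean`): Thm. 1.1 for
`Spec Â`, Lemma 4.7 and the density step, producing the regular local ring `𝒪_{Ŷ,ŷ}` with its
monomial regular system of parameters. As typed there, the head is demanded along valuations `v`
of EVERY rank, whereas the printed proof FIRST reduces to rank one (v1 p. 53: "To begin with, we
may assume that `dim 𝒪_v = 1`, i.e. `Γ_v ⊂ (ℝ, ≥)`, applying [NSp] theorem 1.1 (valid in all
dimensions) or using the dimension three techniques in [CoP1] proposition 5.1") and its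
Lemma 4.7 is [CoP1] Prop. 8.1, a statement about RANK-ONE valuations ("Since `W` has rank one,
we have `n W y_{i2} ≥ W y_{i1}` for some `n ≥ 1`", J. Algebra 320 (2008), p. 1072). This file
inserts the printed rank-one reduction — Novacoski–Spivakovsky's Thm. 1.1, PROVED in the tree
(`RankOneReductionProofs.lean`) and cut to transcendence degree `≤ 3`
(`RankOneReductionTrdeg.lean`, `LocalUniformization3RankOne.lean`) — in front of the head:

* `exists_adjoin_isRegularLocalRing_of_headAt` — the POINTWISE form of
  `cpLocalUniformization_of_head`: the conclusion of (LU) for `A` at ONE valuation ring `O` from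
  the head's output at that `O` (proof verbatim);
* `CossartPiltant2019LU3OfComplete.of_headRankOne` — **`CossartPiltant2019LU3OfComplete` follows
  from surface resolution over fields (`CossartJannsenSaito2020`) and the geometric head for the
  local rings `B_𝔭` ALONG RANK-ONE VALUATIONS ONLY** (the binder `head` of `.of_head` with the
  extra premise `Nonempty O.valuation.RankOne`), i.e. exactly the situation of the printed
  Lemma 4.7 / [CoP1] Prop. 8.1.

Universe `0` for the assembly (the Novacoski–Spivakovsky files are written at `Type`).

## Sources

* V. Cossart, O. Piltant, J. Algebra 529 (2019) 268–535 = arXiv:1412.0868, proof of Prop. 4.8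
  with Lemma 4.7 (arXiv v1: Prop. 4.6, pp. 52–53). [CossartPiltant2019]
* V. Cossart, O. Piltant, J. Algebra 320 (2008) 1051–1082, Prop. 8.1 (rank one).
  [CossartPiltant2008]
* J. Novacoski, M. Spivakovsky (2014), Thm. 1.1. [NovacoskiSpivakovsky2014]
-/

noncomputable section

namespace Literature.AlgebraicGeometry.Resolution

universe u

open IsLocalRing

section HeadAt

variable {A : Type u} [CommRing A] [IsDomain A] [IsLocalRing A] [IsNoetherianRing A]
  {K : Type u} [Field K] [Algebra A K] [IsFractionRing A K]

/-- **(LU) for `A` at one valuation ring from the geometric head at that valuation ring**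
(pointwise form of `cpLocalUniformization_of_head`). Let `A` be a Noetherian local domain
essentially of finite type over a field `k` with fraction field `K`, and `O` a valuation ring of
`K` containing and dominating `A` with residue field algebraic over that of `A`. Suppose that for
every field `K̂₁` under `Â` whose kernel is a minimal prime `P̂₁` with `K̂₁ = QF(Â/P̂₁)`, every
embedding `ι : K → K̂₁` over `A` and every valuation ring `O'` of `K̂₁` containing and dominating
`Â`, with residue field algebraic over that of `Â` and `O' ∩ K = O`, there is a regular local ring
`S` essentially of finite type over `Â`, dominating `Â`, embedded in `K̂₁` over `Â`, contained in
and dominated by `O'`, with generators `z_j` of `𝔪_S`, exponents `a_j ≥ 1`, units `c_j` and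
`g_j ∈ K` with `ι(g_j) = c_j z_j^{a_j}` (`S = 𝒪_{Ŷ,ŷ}` of the printed proof, by Thm. 1.1 for
`Spec Â`, Lemma 4.7 and (511)–(512)). Then some finitely generated `A[t] ⊆ O` is regular at the
centre of `O`. Proof: that of `cpLocalUniformization_of_head` verbatim (extend `v` to
`K̂₁ := QF(Â/P̂₁)` by `exists_minimalPrime_valuationSubring_adicCompletion`, feed the head,
conclude by `exists_adjoin_isRegularLocalRing_of_headData`).
[cite: CossartPiltant2019, proof of Prop. 4.8 (arXiv v1: Prop. 4.6, pp. 52–53)] -/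
theorem exists_adjoin_isRegularLocalRing_of_headAt (k : Type u) [Field k] [Algebra k A]
    [Algebra.EssFiniteType k A] (O : ValuationSubring K)
    (hAO : ∀ x : A, algebraMap A K x ∈ O)
    (hdom : ∀ x ∈ maximalIdeal A, O.valuation (algebraMap A K x) < 1)
    (halg : ∀ y : O, ∃ p : Polynomial A, (∃ i, p.coeff i ∉ maximalIdeal A) ∧
      O.valuation (p.eval₂ (algebraMap A K) y) < 1)
    (headAt : ∀ (K₁ : Type u) [Field K₁] [Algebra (AdicCompletion (maximalIdeal A) A) K₁],
      RingHom.ker (algebraMap (AdicCompletion (maximalIdeal A) A) K₁) ∈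
        minimalPrimes (AdicCompletion (maximalIdeal A) A) →
      (∀ z : K₁, ∃ a b : AdicCompletion (maximalIdeal A) A,
        z = algebraMap _ K₁ a / algebraMap _ K₁ b) →
      ∀ (ι : K →+* K₁), ι.comp (algebraMap A K) =
        (algebraMap (AdicCompletion (maximalIdeal A) A) K₁).comp
          (algebraMap A (AdicCompletion (maximalIdeal A) A)) →
      ∀ (O' : ValuationSubring K₁),
      (∀ x : AdicCompletion (maximalIdeal A) A, algebraMap _ K₁ x ∈ O') →
      (∀ x ∈ (maximalIdeal A).map (algebraMap A (AdicCompletion (maximalIdeal A) A)),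
        O'.valuation (algebraMap _ K₁ x) < 1) →
      (∀ y : O', ∃ p : Polynomial (AdicCompletion (maximalIdeal A) A),
        (∃ i, p.coeff i ∉
          (maximalIdeal A).map (algebraMap A (AdicCompletion (maximalIdeal A) A))) ∧
        O'.valuation (p.eval₂ (algebraMap (AdicCompletion (maximalIdeal A) A) K₁) y) < 1) →
      O'.comap ι = O →
      ∃ (S : Type u) (_ : CommRing S) (_ : IsRegularLocalRing S)
        (_ : Algebra (AdicCompletion (maximalIdeal A) A) S) (_ : Algebra S K₁),
        IsLocalHom (algebraMap (AdicCompletion (maximalIdeal A) A) S) ∧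
        Algebra.EssFiniteType (AdicCompletion (maximalIdeal A) A) S ∧
        IsScalarTower (AdicCompletion (maximalIdeal A) A) S K₁ ∧
        Function.Injective (algebraMap S K₁) ∧
        (∀ s : S, algebraMap S K₁ s ∈ O') ∧
        (∀ s ∈ maximalIdeal S, O'.valuation (algebraMap S K₁ s) < 1) ∧
        ∃ (d : ℕ) (z : Fin d → S) (a : Fin d → ℕ) (c : Fin d → Sˣ) (g : Fin d → K),
          Ideal.span (Set.range z) = maximalIdeal S ∧ (∀ j, 0 < a j) ∧
          ∀ j, ι (g j) = algebraMap S K₁ (c j * z j ^ a j)) :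
    ∃ (t : Finset K) (h : (Algebra.adjoin A (t : Set K)).toSubring ≤ O.toSubring),
      IsRegularLocalRing (Localization.AtPrime
        (Ideal.comap (Subring.inclusion h) (maximalIdeal O))) := by
  set Ah := AdicCompletion (maximalIdeal A) A with hAhdef
  -- Step A: a minimal prime `P` of `Â` with `P ∩ A = 0` carrying an extension of `v`
  obtain ⟨P, hPmin, hPA, H⟩ :=
    exists_minimalPrime_valuationSubring_adicCompletion.{u, u, u} O hAO hdom halg
  haveI hPprime : P.IsPrime := hPmin.1.1
  -- `R := Â/P`, `K̂₁ := QF(R)`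
  haveI : IsLocalRing (Ah ⧸ P) :=
    IsLocalRing.of_surjective' (Ideal.Quotient.mk P) Ideal.Quotient.mk_surjective
  haveI : IsLocalHom (Ideal.Quotient.mk P) :=
    IsLocalHom.of_surjective _ Ideal.Quotient.mk_surjective
  set K₁ := FractionRing (Ah ⧸ P) with hK₁def
  have hRK₁ : Function.Injective (algebraMap (Ah ⧸ P) K₁) := IsFractionRing.injective _ _
  have halgmap : ∀ x : Ah, algebraMap Ah K₁ x = algebraMap (Ah ⧸ P) K₁ (Ideal.Quotient.mk P x) :=
    fun x => IsScalarTower.algebraMap_apply Ah (Ah ⧸ P) K₁ x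
  -- the kernel of `Â → K̂₁` is `P`
  have hker : RingHom.ker (algebraMap Ah K₁) = P := by
    ext x
    rw [RingHom.mem_ker, halgmap, map_eq_zero_iff _ hRK₁, Ideal.Quotient.eq_zero_iff_mem]
  have hP₁ : RingHom.ker (algebraMap Ah K₁) ∈ minimalPrimes Ah := by
    rw [hker]
    exact hPmin
  -- `K̂₁` consists of fractions of elements of `Â`
  have hK₁ : ∀ z : K₁, ∃ a b : Ah, z = algebraMap _ K₁ a / algebraMap _ K₁ b := by
    intro z
    obtain ⟨a, b, -, rfl⟩ := IsFractionRing.div_surjective (A := Ah ⧸ P) z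
    obtain ⟨a', rfl⟩ := Ideal.Quotient.mk_surjective a
    obtain ⟨b', rfl⟩ := Ideal.Quotient.mk_surjective b
    exact ⟨a', b', by rw [halgmap, halgmap]⟩
  -- the embedding `ι : K → K̂₁` extending `A → Â → Â/P → K̂₁` (injective as `P ∩ A = 0`)
  have hinjA : Function.Injective ((algebraMap Ah K₁).comp (algebraMap A Ah)) := by
    rw [injective_iff_map_eq_zero]
    intro x hx
    rw [RingHom.comp_apply] at hx
    have h1 : algebraMap A Ah x ∈ RingHom.ker (algebraMap Ah K₁) := RingHom.mem_ker.mpr hx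
    rw [hker] at h1
    have h2 : x ∈ P.comap (algebraMap A Ah) := Ideal.mem_comap.mpr h1
    rwa [hPA, Ideal.mem_bot] at h2
  obtain ⟨ι, hι⟩ : ∃ ι : K →+* K₁,
      ι.comp (algebraMap A K) = (algebraMap Ah K₁).comp (algebraMap A Ah) :=
    ⟨IsFractionRing.lift hinjA, RingHom.ext fun x => by
      rw [RingHom.comp_apply, RingHom.comp_apply]
      exact IsFractionRing.lift_algebraMap hinjA x⟩
  have hιH : ι.comp (algebraMap A K) =
      (algebraMap (Ah ⧸ P) K₁).comp ((Ideal.Quotient.mk P).comp (algebraMap A Ah)) := by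
    rw [hι]
    refine RingHom.ext fun x => ?_
    rw [RingHom.comp_apply, RingHom.comp_apply, RingHom.comp_apply]
    exact halgmap _
  -- Step A's valuation ring `O'` of `K̂₁`
  obtain ⟨O', hRO', hdomR, halgR, hcomap⟩ := H (Ah ⧸ P) (Ideal.Quotient.mk P)
    Ideal.Quotient.mk_surjective Ideal.mk_ker K₁ hRK₁ ι hιH
  -- its properties in terms of `Â` (`𝔪_A Â ⊆ 𝔪_Â` maps into `𝔪_{Â/P}`)
  have hmR : ∀ x ∈ (maximalIdeal A).map (algebraMap A Ah),
      Ideal.Quotient.mk P x ∈ maximalIdeal (Ah ⧸ P) := fun x hx => by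
    rw [← AdicCompletion.maximalIdeal_eq_map] at hx
    exact (IsLocalRing.mem_maximalIdeal _).mpr fun hu =>
      ((IsLocalRing.mem_maximalIdeal x).mp hx) ((isUnit_map_iff (Ideal.Quotient.mk P) x).mp hu)
  have hRO'' : ∀ x : Ah, algebraMap Ah K₁ x ∈ O' := fun x => by
    rw [halgmap]
    exact hRO' _
  have hdom'' : ∀ x ∈ (maximalIdeal A).map (algebraMap A Ah),
      O'.valuation (algebraMap Ah K₁ x) < 1 := fun x hx => by
    rw [halgmap]
    exact hdomR _ (hmR x hx)
  have hcompR : (algebraMap (Ah ⧸ P) K₁).comp (Ideal.Quotient.mk P) = algebraMap Ah K₁ :=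
    RingHom.ext fun x => (halgmap x).symm
  have halg'' : ∀ y : O', ∃ p : Polynomial Ah,
      (∃ i, p.coeff i ∉ (maximalIdeal A).map (algebraMap A Ah)) ∧
      O'.valuation (p.eval₂ (algebraMap Ah K₁) y) < 1 := by
    intro y
    obtain ⟨p, ⟨i, hi⟩, hlt⟩ := halgR y
    obtain ⟨q, rfl⟩ :=
      Polynomial.map_surjective (Ideal.Quotient.mk P) Ideal.Quotient.mk_surjective p
    refine ⟨q, ⟨i, fun hqi => hi ?_⟩, ?_⟩
    · rw [Polynomial.coeff_map]
      exact hmR _ hqi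
    · rwa [Polynomial.eval₂_map, hcompR] at hlt
  -- the head
  obtain ⟨S, _, _, _, _, hloc, hess, htower, hSK₁, hSO', hdomS, d, z, a, c, g, hz, ha, hg⟩ :=
    headAt K₁ hP₁ hK₁ ι hι O' hRO'' hdom'' halg'' hcomap
  haveI := hloc
  haveI := hess
  haveI := htower
  exact exists_adjoin_isRegularLocalRing_of_headData k hP₁ hK₁ ι hι O' halg'' O hcomap hSK₁ hSO'
    hdomS z hz a ha c g hg

end HeadAt

/-! ## The descent leaf from the head along rank-one valuations -/

/-- **The descent leaf reduced to its geometric head ALONG RANK-ONE VALUATIONS.**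
`CossartPiltant2019LU3OfComplete` (= `CossartPiltant2019LUComplete3 → CossartPiltant2019LU3`,
Cossart–Piltant 2019 journal Prop. 4.8 = arXiv v1 Prop. 4.6) follows from surface resolution over
fields (`CossartJannsenSaito2020`) together with the geometric head of the printed proof for the
local rings `A = B_𝔭` (`B` a domain of finite type over a field `k`, `𝔭` maximal,
`dim B = dim B_𝔭 = 3`) in the format of `CossartPiltant2019LU3OfComplete.of_head`, BUT ONLY for
valuation rings `O` of RANK ONE (`Nonempty O.valuation.RankOne`) — the situation of the printed
proof after its opening reduction ("we may assume that `dim 𝒪_v = 1` … applying [NSp]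
theorem 1.1") and of its Lemma 4.7 (= [CoP1] Prop. 8.1, rank one). Proof: Novacoski–Spivakovsky's
reduction in transcendence degree `≤ 3` and the closed-points reduction at rank one
(`localUniformization3_of_closedPoints_rankOne`), then the pointwise head
(`exists_adjoin_isRegularLocalRing_of_headAt`). Universe `0`.
[cite: CossartPiltant2019, Props. 4.6 and 4.8 with Lemma 4.7 (arXiv v1: Props. 4.4 and 4.6, pp. 50–53)]
[cite: NovacoskiSpivakovsky2014, Thm. 1.1] -/
theorem CossartPiltant2019LU3OfComplete.of_headRankOne (hCJS : CossartJannsenSaito2020.{0})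
    (head : CossartPiltant2019LUComplete3.{0} →
      ∀ (k B : Type) [Field k] [CommRing B] [IsDomain B] [Algebra k B] [Algebra.FiniteType k B]
        (p : Ideal B) [p.IsMaximal], ringKrullDim B = 3 →
        ringKrullDim (Localization.AtPrime p) = 3 →
      ∀ (K : Type) [Field K] [Algebra (Localization.AtPrime p) K]
        [IsFractionRing (Localization.AtPrime p) K] (O : ValuationSubring K),
      Nonempty O.valuation.RankOne →
      (∀ x : Localization.AtPrime p, algebraMap _ K x ∈ O) →
      (∀ x ∈ maximalIdeal (Localization.AtPrime p), O.valuation (algebraMap _ K x) < 1) →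
      (∀ y : O, ∃ q : Polynomial (Localization.AtPrime p),
        (∃ i, q.coeff i ∉ maximalIdeal (Localization.AtPrime p)) ∧
        O.valuation (q.eval₂ (algebraMap _ K) y) < 1) →
      ∀ (K₁ : Type) [Field K₁]
        [Algebra (AdicCompletion (maximalIdeal (Localization.AtPrime p))
          (Localization.AtPrime p)) K₁],
      RingHom.ker (algebraMap (AdicCompletion (maximalIdeal (Localization.AtPrime p))
          (Localization.AtPrime p)) K₁) ∈
        minimalPrimes (AdicCompletion (maximalIdeal (Localization.AtPrime p))
          (Localization.AtPrime p)) →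
      (∀ z : K₁, ∃ a b : AdicCompletion (maximalIdeal (Localization.AtPrime p))
          (Localization.AtPrime p), z = algebraMap _ K₁ a / algebraMap _ K₁ b) →
      ∀ (ι : K →+* K₁), ι.comp (algebraMap (Localization.AtPrime p) K) =
        (algebraMap (AdicCompletion (maximalIdeal (Localization.AtPrime p))
          (Localization.AtPrime p)) K₁).comp (algebraMap (Localization.AtPrime p) _) →
      ∀ (O' : ValuationSubring K₁),
      (∀ x : AdicCompletion (maximalIdeal (Localization.AtPrime p)) (Localization.AtPrime p),
        algebraMap _ K₁ x ∈ O') →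
      (∀ x ∈ (maximalIdeal (Localization.AtPrime p)).map (algebraMap (Localization.AtPrime p)
          (AdicCompletion (maximalIdeal (Localization.AtPrime p)) (Localization.AtPrime p))),
        O'.valuation (algebraMap _ K₁ x) < 1) →
      (∀ y : O', ∃ q : Polynomial (AdicCompletion (maximalIdeal (Localization.AtPrime p))
          (Localization.AtPrime p)),
        (∃ i, q.coeff i ∉ (maximalIdeal (Localization.AtPrime p)).map
          (algebraMap (Localization.AtPrime p)
            (AdicCompletion (maximalIdeal (Localization.AtPrime p)) (Localization.AtPrime p)))) ∧
        O'.valuation (q.eval₂ (algebraMap _ K₁) y) < 1) →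
      O'.comap ι = O →
      ∃ (S : Type) (_ : CommRing S) (_ : IsRegularLocalRing S)
        (_ : Algebra (AdicCompletion (maximalIdeal (Localization.AtPrime p))
          (Localization.AtPrime p)) S) (_ : Algebra S K₁),
        IsLocalHom (algebraMap (AdicCompletion (maximalIdeal (Localization.AtPrime p))
          (Localization.AtPrime p)) S) ∧
        Algebra.EssFiniteType (AdicCompletion (maximalIdeal (Localization.AtPrime p))
          (Localization.AtPrime p)) S ∧
        IsScalarTower (AdicCompletion (maximalIdeal (Localization.AtPrime p))
          (Localization.AtPrime p)) S K₁ ∧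
        Function.Injective (algebraMap S K₁) ∧
        (∀ s : S, algebraMap S K₁ s ∈ O') ∧
        (∀ s ∈ maximalIdeal S, O'.valuation (algebraMap S K₁ s) < 1) ∧
        ∃ (d : ℕ) (z : Fin d → S) (a : Fin d → ℕ) (c : Fin d → Sˣ) (g : Fin d → K),
          Ideal.span (Set.range z) = maximalIdeal S ∧ (∀ j, 0 < a j) ∧
          ∀ j, ι (g j) = algebraMap S K₁ (c j * z j ^ a j)) :
    CossartPiltant2019LU3OfComplete.{0} :=
  fun hc k _ => localUniformization3_of_closedPoints_rankOne hCJS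
    (fun k B _ _ _ _ _ p _ h1 h2 K _ _ _ O hrk hAO hdom halg => by
      haveI : IsNoetherianRing B := Algebra.FiniteType.isNoetherianRing k B
      haveI : IsNoetherianRing (Localization.AtPrime p) :=
        IsLocalization.isNoetherianRing p.primeCompl _ inferInstance
      exact exists_adjoin_isRegularLocalRing_of_headAt k O hAO hdom halg
        (head hc k B p h1 h2 K O hrk hAO hdom halg)) k

end Literature.AlgebraicGeometry.Resolution

end
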